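import Summits.NavierStokesRegularity.NavierStokesRegularity.Theorems.ScenarioCensusInertialMeterAccel
import Literature.Analysis.FluidPDE.LeiZhang2011Proofs
import Summits.NavierStokesRegularity.NavierStokesRegularity.Theorems.SoloSalvageWu2026ConstructCompactV
import Summits.NavierStokesRegularity.NavierStokesRegularity.Theorems.UnthreadedRigidityDoorUnthreadedRigidityThreadingJets
import Summits.NavierStokesRegularity.NavierStokesRegularity.Theorems.StrainDoorsTypeIAncientCompactness
import HarnessLib

/-!
# INERTIAL METER port, part 3/3: §G the census rows ((L′)-shape: `Row_A2inV` / `P` / `T` / `B` / `A` / `W` DECIDED, `Row_A2inS` / `Row_A2inG` OPEN typed), nestings, `rows_of_L'` / `rows_of_rung`; census KEYS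

Re-homed for the scenario census (typer seat ns-census-typer-1 g10; the cells A2inV / A2inP / A2inT / A2inB / A2inA / A2inW are MEMBERS OF RECORD «DECIDED IN KERNEL IN FILES» of row A2
(item 88: critic idea-crit-3 g10 PASS no price 13:11:05Z; ref ns-census-ref g15 PRE-CHECK ✓ §20.4; lead label v1.120; OF RECORD 4/4 at v1.122), A2inS / A2inG OPEN (typed); this port makes
the decided cells TREE-decided): VERBATIM PORT of ns-idea-2 LINE g18-1 «inertial-meter», `pub/ideators/ns-idea-2/lines/inertial-meter/line-inertial-meter.lean` sha16 78017c94d7e034e6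
(708 l., lean check rc 0, 0 sorry), split for the 400-line rule into `ScenarioCensusInertialMeter` (§A–§D) → `…InertialMeterAccel` (§E–§F) → `…InertialMeterRows` (§G + census KEYS).  Lean text VERBATIM in
namespace `…Theorems.ScenarioCensus.InertialMeter` (the line's `…Lines.InertialMeter` re-homed); port edits: the line's `local notation "E3"` is spelled as the reducible `abbrev E3` of
every census file; elementary lemmas the line restates are the tree's BY NAME (gate lint dedup.landed): `integrableOn_ball_of_continuous` = `Wu2026Salvage.integrableOn_ball_of_continuous`,
`volume_real_ball` = `volume_real_ball_eq` (Literature, Lei–Zhang 2011 proofs), `curl_sub_apply` = `UnthreadedRigidity.ThreadingJets.curl_fun_sub`, `curl_comp_add_right` = `StrainDoors.curl_comp_add_right_apply` (their modules are imported; none imports a route file), and `timeDeriv_eq_fderiv_uncurry` / `analyticAt_clm_apply` / `analyticOnNhd_timeDeriv` = the landed GENERATOR METER's (`GeneratorMeter.…`, BY NAME);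
`volume_real_unitBall_pos` (twin of a lemma in a route-cone module) and `divergence_sub_apply` (twin of a Literature lemma whose module is outside this closure) are not re-declared, their short proofs are inlined at the use sites; `set_option linter.unusedVariables false` dropped;
`@[conjecture]` on the OPEN rows `Row_A2inS`, `Row_A2inG`; one-line docstrings added where missing (gate lint).  Statements untouched.

No census VALUE is moved here (row A2 stays OPEN-WITH-LINE; the members become TREE-decided by name); (L′) is NOT proved; no summit statement is proved by this file. Lemmas that restate already-landed tree declarations are taken BY NAME (gate lint `dedup.landed`): `integrableOn_ball_of_continuous` = `Wu2026Salvage.integrableOn_ball_of_continuous`, `volume_real_ball` = `volume_real_ball_eq`, `curl_sub_apply` = `UnthreadedRigidity.ThreadingJets.curl_fun_sub`, `curl_comp_add_right` = `StrainDoors.curl_comp_add_right_apply`, `timeDeriv_eq_fderiv_uncurry` = `GeneratorMeter.timeDeriv_eq_fderiv_uncurry`, `analyticAt_clm_apply` = `GeneratorMeter.analyticAt_clm_apply`, `analyticOnNhd_timeDeriv` = `GeneratorMeter.analyticOnNhd_timeDeriv`.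
-/

-- the summit and its single problem share the name `NavierStokesRegularity` (D-0017 nested layout)
set_option linter.dupNamespace false

noncomputable section

open Set Function Filter Metric MeasureTheory
open scoped Topology
open Literature.Analysis Literature.Analysis.FluidPDE
open Summit.NavierStokesRegularity.NavierStokesRegularity.Theorems
open Summit.NavierStokesRegularity.NavierStokesRegularity.Theorems.ScenarioCensus

namespace Summit.NavierStokesRegularity.NavierStokesRegularity.Theorems.ScenarioCensus.InertialMeter

variable {C C' : ℝ} {u v : ℝ → E3 → E3}

/-! ## G. Census rows ((L′)-shape, BY NAME over `IsTypeIAncientMild`) and verdicts -/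

/-- Row A2inV — «the VORTICITY of a Type-I ancient mild field RECURS IN TIME on a pocket: `curl u(t₀,·) =
curl u(t₀−δ,·)` on a nonempty open set, `δ > 0`» ⇒ `u ≡ 0`.  DECIDED (proved: `eq_zero_of_vorticityRecurrent_pocket`). -/
def Row_A2inV : Prop :=
  ∀ (C : ℝ) (u : ℝ → E3 → E3), IsTypeIAncientMild C u →
    (∃ (t₀ δ : ℝ) (U : Set E3), t₀ < 0 ∧ 0 < δ ∧ IsOpen U ∧ U.Nonempty ∧
      ∀ x ∈ U, curl (u t₀) x = curl (u (t₀ - δ)) x) →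
    ∀ t < 0, ∀ x, u t x = 0

/-- **Row A2inV holds.** -/
theorem row_A2inV : Row_A2inV := by
  rintro C u hu ⟨t₀, δ, U, ht₀, hδ, hU, hne, h⟩
  exact eq_zero_of_vorticityRecurrent_pocket hu hδ ht₀ hU hne h

/-- Row A2inP — «the vorticity of ONE slice is `a`-PERIODIC on a pocket, `a ≠ 0`» ⇒ `u ≡ 0`.  DECIDED
(proved: `eq_zero_of_vorticityPeriodic_pocket`). -/
def Row_A2inP : Prop :=
  ∀ (C : ℝ) (u : ℝ → E3 → E3), IsTypeIAncientMild C u →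
    (∃ (t₀ : ℝ) (a : E3) (U : Set E3), t₀ < 0 ∧ a ≠ 0 ∧ IsOpen U ∧ U.Nonempty ∧
      ∀ x ∈ U, curl (u t₀) (x + a) = curl (u t₀) x) →
    ∀ t < 0, ∀ x, u t x = 0

/-- **Row A2inP holds.** -/
theorem row_A2inP : Row_A2inP := by
  rintro C u hu ⟨t₀, a, U, ht₀, ha, hU, hne, h⟩
  exact eq_zero_of_vorticityPeriodic_pocket hu ha ht₀ hU hne h

/-- Row A2inT — «a velocity germ RECURS IN TIME UP TO A BOOST: `u(t₀,x) = u(t₀−δ,x) + b` on a nonempty open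
set, `δ > 0`» ⇒ `u ≡ 0`.  DECIDED (proved: `eq_zero_of_boostedRecurrent_germ`; `b = 0` is the tree's
`eq_zero_of_germ_timeRecurrent`). -/
def Row_A2inT : Prop :=
  ∀ (C : ℝ) (u : ℝ → E3 → E3), IsTypeIAncientMild C u →
    (∃ (t₀ δ : ℝ) (U : Set E3) (b : E3), t₀ < 0 ∧ 0 < δ ∧ IsOpen U ∧ U.Nonempty ∧
      ∀ x ∈ U, u t₀ x = u (t₀ - δ) x + b) →
    ∀ t < 0, ∀ x, u t x = 0

/-- **Row A2inT holds.** -/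
theorem row_A2inT : Row_A2inT := by
  rintro C u hu ⟨t₀, δ, U, b, ht₀, hδ, hU, hne, h⟩
  exact eq_zero_of_boostedRecurrent_germ hu hδ ht₀ hU hne h

/-- Row A2inB — «a velocity germ RECURS UNDER A TRANSLATION UP TO A BOOST: `u(t₀,x+a) = u(t₀,x) + b` on a
nonempty open set, `a ≠ 0`» ⇒ `u ≡ 0`.  DECIDED (proved: `eq_zero_of_boostedPeriodic_germ`; `b = 0` is
generator-meter `Row_A2gnP` / census A13). -/
def Row_A2inB : Prop :=
  ∀ (C : ℝ) (u : ℝ → E3 → E3), IsTypeIAncientMild C u →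
    (∃ (t₀ : ℝ) (a : E3) (U : Set E3) (b : E3), t₀ < 0 ∧ a ≠ 0 ∧ IsOpen U ∧ U.Nonempty ∧
      ∀ x ∈ U, u t₀ (x + a) = u t₀ x + b) →
    ∀ t < 0, ∀ x, u t x = 0

/-- **Row A2inB holds.** -/
theorem row_A2inB : Row_A2inB := by
  rintro C u hu ⟨t₀, a, U, b, ht₀, ha, hU, hne, h⟩
  exact eq_zero_of_boostedPeriodic_germ hu ha ht₀ hU hne h

/-- Row A2inA — «UNIFORMLY ACCELERATING INSTANT: `∂ₜu(t₀,·)` is a constant vector on a germ of one slice»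
⇒ `u ≡ 0`.  DECIDED (proved: `eq_zero_of_accelInstant_germ`; `b = 0` is the tree's steady slice ⟨10572⟩). -/
def Row_A2inA : Prop :=
  ∀ (C : ℝ) (u : ℝ → E3 → E3), IsTypeIAncientMild C u →
    (∃ (t₀ : ℝ) (U : Set E3) (b : E3), t₀ < 0 ∧ IsOpen U ∧ U.Nonempty ∧
      ∀ x ∈ U, timeDeriv u t₀ x = b) →
    ∀ t < 0, ∀ x, u t x = 0

/-- **Row A2inA holds.** -/
theorem row_A2inA : Row_A2inA := by
  rintro C u hu ⟨t₀, U, b, ht₀, hU, hne, h⟩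
  exact eq_zero_of_accelInstant_germ hu ht₀ hU hne h

/-- Row A2inW — «FROZEN-VORTICITY POCKET: `∂ₜ curl u(·, x)` vanishes at `t₀` for every `x` in a nonempty open
set» ⇒ `u ≡ 0`.  DECIDED (proved: `eq_zero_of_frozenVorticity_pocket`). -/
def Row_A2inW : Prop :=
  ∀ (C : ℝ) (u : ℝ → E3 → E3), IsTypeIAncientMild C u →
    (∃ (t₀ : ℝ) (U : Set E3), t₀ < 0 ∧ IsOpen U ∧ U.Nonempty ∧
      ∀ x ∈ U, deriv (fun s => curl (u s) x) t₀ = 0) →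
    ∀ t < 0, ∀ x, u t x = 0

/-- **Row A2inW holds.** -/
theorem row_A2inW : Row_A2inW := by
  rintro C u hu ⟨t₀, U, ht₀, hU, hne, h⟩
  exact eq_zero_of_frozenVorticity_pocket hu ht₀ hU hne h

/-- Row A2inS — «the vorticity of ONE slice is DSS-RELATED on a pocket: `curl u_λ(t₀,·) = curl u(t₀,·)` on a
nonempty open set for some `λ > 0`, `λ ≠ 1`» ⇒ `u ≡ 0`.  OPEN (typed only): by `dss_of_vorticityDssPocket`
the element is EXACTLY `λ`-DSS, i.e. the cell IS census D7 ∩ A_C (Type-I backward-DSS elements), open in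
print and in the tree.  No claim. -/
@[conjecture] def Row_A2inS : Prop :=
  ∀ (C : ℝ) (u : ℝ → E3 → E3), IsTypeIAncientMild C u →
    (∃ (t₀ c : ℝ) (U : Set E3), t₀ < 0 ∧ 0 < c ∧ c ≠ 1 ∧ IsOpen U ∧ U.Nonempty ∧
      ∀ x ∈ U, curl (nsRescale c u t₀) x = curl (u t₀) x) →
    ∀ t < 0, ∀ x, u t x = 0

/-- Row A2inG — «VORTICITY FROZEN IN A MOVING FRAME on a pocket: `∂ₜω(t₀,x) + Dω(t₀,x)[c] = 0` for `x` in a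
nonempty open set, `c ≠ 0`» ⇒ `u ≡ 0`.  OPEN (typed only): the Galilean twin of the generator meter's
travelling instant `Row_A2gnT` (ns-idea-2 g17-3, OPEN); the reduction «⇒ `∂ₜu + Du[c]` is a constant vector
on `ℝ³`» holds by §B but the constant is a boost PLUS a flux term, and bounded travelling profiles have no
Liouville theorem.  No claim. -/
@[conjecture] def Row_A2inG : Prop :=
  ∀ (C : ℝ) (u : ℝ → E3 → E3), IsTypeIAncientMild C u →
    (∃ (t₀ : ℝ) (c : E3) (U : Set E3), t₀ < 0 ∧ c ≠ 0 ∧ IsOpen U ∧ U.Nonempty ∧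
      ∀ x ∈ U, deriv (fun s => curl (u s) x) t₀ + fderiv ℝ (curl (u t₀)) x c = 0) →
    ∀ t < 0, ∀ x, u t x = 0

/-- Nesting: the boosted velocity twins are sub-cells of the vorticity rows (a boost has no vorticity). -/
theorem row_A2inT_of_row_A2inV : Row_A2inV → Row_A2inT := fun hV C u hu ⟨t₀, δ, U, b, ht₀, hδ, hU, hne, h⟩ =>
  hV C u hu ⟨t₀, δ, U, ht₀, hδ, hU, hne, fun x hx => by
    have hev : (u t₀) =ᶠ[𝓝 x] fun y => u (t₀ - δ) y + b :=
      Filter.eventually_of_mem (hU.mem_nhds hx) fun y hy => h y hy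
    rw [curl_eq_curlCLM, curl_eq_curlCLM, hev.fderiv_eq, fderiv_add_const]⟩

/-- Nesting: A2inW → A2inA. -/
theorem row_A2inA_of_row_A2inW : Row_A2inW → Row_A2inA := fun hW C u hu ⟨t₀, U, b, ht₀, hU, hne, h⟩ =>
  hW C u hu ⟨t₀, U, ht₀, hU, hne, fun x hx => by
    rw [deriv_curl_eq_curl_timeDeriv hu ht₀ x]
    have hev : (fun y => timeDeriv u t₀ y) =ᶠ[𝓝 x] fun _ => b :=
      Filter.eventually_of_mem (hU.mem_nhds hx) fun y hy => h y hy
    rw [curl_eq_curlCLM, hev.fderiv_eq, fderiv_const_apply, map_zero]⟩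

/-- Every row follows from (L′) «every Type-I ancient mild field vanishes». -/
theorem rows_of_L' (hL : ∀ (C : ℝ) (u : ℝ → E3 → E3), IsTypeIAncientMild C u → ∀ t < 0, ∀ x, u t x = 0) :
    Row_A2inV ∧ Row_A2inP ∧ Row_A2inT ∧ Row_A2inB ∧ Row_A2inA ∧ Row_A2inW ∧ Row_A2inS ∧ Row_A2inG :=
  ⟨fun C u hu _ => hL C u hu, fun C u hu _ => hL C u hu, fun C u hu _ => hL C u hu,
    fun C u hu _ => hL C u hu, fun C u hu _ => hL C u hu, fun C u hu _ => hL C u hu,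
    fun C u hu _ => hL C u hu, fun C u hu _ => hL C u hu⟩

/-- **The rung decides every row**: the LADDER-NS rung (L′) `Theses.SymmetryModuliCount.TypeIAncientLiouville`
⟨stmt-NavierStokesRegularity-10661⟩, BY NAME, implies every row of the inertial meter (including the open
`Row_A2inS`, `Row_A2inG`).  Nothing here proves the rung.  No summit is proved by a line. -/
theorem rows_of_rung (hL : Theses.SymmetryModuliCount.TypeIAncientLiouville) :
    Row_A2inV ∧ Row_A2inP ∧ Row_A2inT ∧ Row_A2inB ∧ Row_A2inA ∧ Row_A2inW ∧ Row_A2inS ∧ Row_A2inG :=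
  rows_of_L' fun C u hu => hL C u (isTypeIAncientMild_iff.1 hu)

end Summit.NavierStokesRegularity.NavierStokesRegularity.Theorems.ScenarioCensus.InertialMeter

namespace Summit.NavierStokesRegularity.NavierStokesRegularity.Theorems.ScenarioCensus

/-! ## Census KEYS (ns `…Theorems.ScenarioCensus`): instrument INERTIAL METER (block A2) — TREE-decided cells A2inV / A2inP / A2inT / A2inB / A2inA / A2inW, OPEN rows A2inS / A2inG -/

/-- **Cell A2inV** (the VORTICITY of one slice agrees on a pocket with the vorticity of the time-shifted element ⇒ `u ≡ 0`; vorticity-pocket rigidity): `:= InertialMeter.Row_A2inV`. DECIDED. -/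
def Row_A2inV : Prop := InertialMeter.Row_A2inV
/-- A2inV is EXCLUDED (decided in the tree): `InertialMeter.row_A2inV`. -/
theorem row_A2inV_excluded : Row_A2inV := InertialMeter.row_A2inV

/-- **Cell A2inP** (vorticity of one slice PERIODIC on a pocket, `a ≠ 0` ⇒ `u ≡ 0`; census A13 BY NAME): `:= InertialMeter.Row_A2inP`. DECIDED. -/
def Row_A2inP : Prop := InertialMeter.Row_A2inP
/-- A2inP is EXCLUDED (decided in the tree): `InertialMeter.row_A2inP`. -/
theorem row_A2inP_excluded : Row_A2inP := InertialMeter.row_A2inP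

/-- **Cell A2inT**: `:= InertialMeter.Row_A2inT`. DECIDED. -/
def Row_A2inT : Prop := InertialMeter.Row_A2inT
/-- A2inT is EXCLUDED (decided in the tree): `InertialMeter.row_A2inT`. -/
theorem row_A2inT_excluded : Row_A2inT := InertialMeter.row_A2inT

/-- **Cell A2inB** (the field read modulo BOOSTS): `:= InertialMeter.Row_A2inB`. DECIDED. -/
def Row_A2inB : Prop := InertialMeter.Row_A2inB
/-- A2inB is EXCLUDED (decided in the tree): `InertialMeter.row_A2inB`. -/
theorem row_A2inB_excluded : Row_A2inB := InertialMeter.row_A2inB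

/-- **Cell A2inA** (no uniform ACCELERATION pocket): `:= InertialMeter.Row_A2inA`. DECIDED. -/
def Row_A2inA : Prop := InertialMeter.Row_A2inA
/-- A2inA is EXCLUDED (decided in the tree): `InertialMeter.row_A2inA`. -/
theorem row_A2inA_excluded : Row_A2inA := InertialMeter.row_A2inA

/-- **Cell A2inW** (frozen-vorticity pocket): `:= InertialMeter.Row_A2inW`. DECIDED. -/
def Row_A2inW : Prop := InertialMeter.Row_A2inW
/-- A2inW is EXCLUDED (decided in the tree): `InertialMeter.row_A2inW`. -/
theorem row_A2inW_excluded : Row_A2inW := InertialMeter.row_A2inW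

/-- **Row A2inS** — typed only (= D7 ∩ A_C): `:= InertialMeter.Row_A2inS`. OPEN. -/
@[conjecture] def Row_A2inS : Prop := InertialMeter.Row_A2inS

/-- **Row A2inG** — typed only: `:= InertialMeter.Row_A2inG`. OPEN. -/
@[conjecture] def Row_A2inG : Prop := InertialMeter.Row_A2inG

/-- Lattice edges at key level: A2inV → A2inT, A2inW → A2inA (`InertialMeter.row_A2inT_of_row_A2inV` / `row_A2inA_of_row_A2inW`). -/
theorem row_A2inT_of_row_A2inV : Row_A2inV → Row_A2inT := InertialMeter.row_A2inT_of_row_A2inV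
/-- See `row_A2inT_of_row_A2inV`. -/
theorem row_A2inA_of_row_A2inW : Row_A2inW → Row_A2inA := InertialMeter.row_A2inA_of_row_A2inW

end Summit.NavierStokesRegularity.NavierStokesRegularity.Theorems.ScenarioCensus

end
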